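import Literature.NumberTheory.DiophantineApproximation.PolylogShiftLinearIndependence
import Literature.NumberTheory.DiophantineApproximation.PolylogShiftDivisorBridge
import Literature.NumberTheory.DiophantineApproximation.PolylogShiftTowerLinearIndependence
import HarnessLib

/-!
# Linear independence of `1, Li_s(1/N^d)` (`d ≤ D`, `s ≤ w`) over `ℚ` for `log N ≥ 4m²(w+1)³`, `1, …, D ∣ m`

Topic `Literature/NumberTheory/DiophantineApproximation`. The consecutive-powers case of the distinct-shifts theorem
`one_lerchShift_linearIndependent` (`PolylogShiftLinearIndependence.lean`) read through the divisor bridge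
`PolylogShiftDivisorBridge.lean`: for all `D ≥ 1`, `w ≥ 1`, every common multiple `m ≥ 2` of `1, …, D` and every
integer `N` with `log N ≥ 4m²(w+1)³` (so that `log N^m ≥ 4 m³ (w+1)³`) the `Dw + 1` real numbers

  `1`,  `Li_s(1/N^d)`   (`1 ≤ d ≤ D`, `1 ≤ s ≤ w`)

are linearly independent over `ℚ` (`one_polylog_powers_linearIndependent`; `Li_s(x) = ∑_{k ≥ 0} x^{k+1}/(k+1)^s` is
`DilogPade.polylogSeries s x`, the index `d : Fin D` stands for the exponent `d + 1`). These are the values carried by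
the levels `N, N², …, N^D` of the Kontsevich–Zagier box sectors.

## Proof

With `y = 1/N^m` and `Φ_{s,r} = Φ_{s,r}(y)` (`r ≤ m`, `ShiftPade.lerchShift m r s y`), the bridge gives, for `d ∣ m`,
`Li_s(1/N^d) = ∑_{d ∣ r} d^s N^{m−r} Φ_{s,r}` (`ShiftPade.polylogSeries_pow_eq_sum_ite`), so a relation
`a + ∑_{s,d} b_{s,d} Li_s(1/N^d) = 0` is a relation among `1` and the `Φ_{s,r}` with the coefficients
`B_{s,r} = ∑_{d ∣ r} b_{s,d} d^s N^{m−r}` (`ShiftPade.powers_row`), all of which vanish by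
`one_lerchShift_linearIndependent` (`log N^m = m log N ≥ 4m³(w+1)³`). At `r = d₀ ≤ D` this reads
`∑_{d ∣ d₀} d^s b_{s,d} = 0`, a unitriangular system along divisibility: by strong induction on `d₀` every `b_{s,d}`
with `d` a proper divisor of `d₀` vanishes, whence `d₀^s b_{s,d₀} = 0` (`ShiftPade.powers_descent`); finally `a = 0`.

References: S. David, N. Hirata-Kohno, M. Kawashima, *Can polylogarithms at algebraic points be linearly independent?*,
Moscow J. Comb. Number Th. 9 (2020), Thm 2.1, and *Linear independence criteria for generalized polylogarithms with
distinct shifts*, arXiv:2010.09167. Crude threshold, no optimality. -- TODO(general form): algebraic points, arbitrary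
finite sets of levels `N^d` (any `d`, via `m = lcm`), the thresholds of the papers.
-/

open Finset

namespace Literature.NumberTheory.DiophantineApproximation

namespace ShiftPade

/-- **Unitriangular solving along divisibility**: if `c_d ≠ 0` for all `d < D` and
`∑_{d < D, d+1 ∣ d₀+1} c_d b_d = 0` for every `d₀ < D`, then `b = 0` (strong induction on `d₀`: the proper divisors
`d + 1` of `d₀ + 1` have `d < d₀`). [folklore] -/
theorem powers_descent {D : ℕ} (c b : Fin D → ℚ) (hc : ∀ d, c d ≠ 0)
    (hE : ∀ d₀ < D, (∑ d : Fin D, if ((d : ℕ) + 1) ∣ d₀ + 1 then c d * b d else 0) = 0) :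
    b = 0 := by
  have key : ∀ d₀, ∀ hd : d₀ < D, b ⟨d₀, hd⟩ = 0 := by
    intro d₀
    induction d₀ using Nat.strong_induction_on with
    | _ d₀ ih =>
      intro hd
      have h1 := hE d₀ hd
      rw [sum_eq_single_of_mem (⟨d₀, hd⟩ : Fin D) (mem_univ _), if_pos (dvd_refl _)] at h1
      · rcases mul_eq_zero.1 h1 with h3 | h3
        · exact absurd h3 (hc _)
        · exact h3
      · intro d _ hne
        by_cases hdv : ((d : ℕ) + 1) ∣ d₀ + 1
        · have hle : (d : ℕ) + 1 ≤ d₀ + 1 := Nat.le_of_dvd (Nat.succ_pos _) hdv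
          have hne' : (d : ℕ) ≠ d₀ := fun h => hne (Fin.ext h)
          have h4 : b d = 0 := ih d (by omega) d.isLt
          rw [if_pos hdv, h4, mul_zero]
        · rw [if_neg hdv]
  funext d
  exact key d d.isLt

/-- **One row of the powers in the `Φ`-basis**: for `N ≥ 2`, `m ≥ 1` a common multiple of `1, …, D`, every `s` and
rational `b_d` (`d < D`), `∑_{d<D} b_d Li_s(1/N^{d+1}) = ∑_{r<m} B_r Φ_{s,r+1}(1/N^m)` with
`B_r = ∑_{d<D} b_d [d+1 ∣ r+1] (d+1)^s N^{m−(r+1)}` (the divisor bridge at `1/N^{d+1}`, `m = (d+1)·(m/(d+1))`).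
[cite: DavidHirataKohnoKawashima2020, Thm 2.1] -/
theorem powers_row {D N m : ℕ} (hN : 2 ≤ N) (hm : 1 ≤ m) (hdiv : ∀ d, 1 ≤ d → d ≤ D → d ∣ m) (s : ℕ)
    (b : Fin D → ℚ) :
    ∑ d : Fin D, (b d : ℝ) * DilogPade.polylogSeries s (1 / (N : ℝ) ^ ((d : ℕ) + 1)) =
      ∑ r ∈ range m, ((∑ d : Fin D, b d *
          (if ((d : ℕ) + 1) ∣ r + 1 then (((d : ℕ) + 1 : ℕ) : ℚ) ^ s * (N : ℚ) ^ (m - (r + 1)) else 0) : ℚ) : ℝ) *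
        lerchShift m (r + 1) s (1 / (N : ℝ) ^ m) := by
  have hrow : ∀ d : Fin D, DilogPade.polylogSeries s (1 / (N : ℝ) ^ ((d : ℕ) + 1)) =
      ∑ r ∈ range m, (if ((d : ℕ) + 1) ∣ r + 1 then
          (((d : ℕ) + 1 : ℕ) : ℝ) ^ s * (N : ℝ) ^ (m - (r + 1)) else 0) *
        lerchShift m (r + 1) s (1 / (N : ℝ) ^ m) := by
    intro d
    obtain ⟨e, he⟩ := hdiv ((d : ℕ) + 1) (by omega) (by have := d.isLt; omega)
    refine polylogSeries_pow_eq_sum_ite s hN (by omega) (Nat.pos_of_ne_zero ?_) he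
    rintro rfl
    rw [mul_zero] at he
    omega
  simp_rw [hrow, mul_sum, ← mul_assoc]
  rw [sum_comm]
  refine sum_congr rfl fun r _ => ?_
  rw [← sum_mul]
  congr 1
  push_cast [ratCast_ite]
  rfl

end ShiftPade

open ShiftPade

/-- **Linear independence of `1, Li_s(1/N^d)` (`1 ≤ d ≤ D`, `1 ≤ s ≤ w`) over `ℚ`** for `D, w ≥ 1`, `m ≥ 2` a common
multiple of `1, …, D` and `log N ≥ 4m²(w+1)³`: every rational relation
`a + ∑_{j<w} ∑_{d<D} b_{j,d} Li_{j+1}(1/N^{d+1}) = 0` is trivial — the rigidity input of the consecutive power levels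
`N, N², …, N^D` (the distinct-shifts theorem at `y = 1/N^m` through the divisor bridge).
[cite: DavidHirataKohnoKawashima2020, Thm 2.1] -/
theorem one_polylog_powers_linearIndependent (D w m : ℕ) (hD : 1 ≤ D) (hw : 1 ≤ w) (hm : 2 ≤ m)
    (hdiv : ∀ d, 1 ≤ d → d ≤ D → d ∣ m) (N : ℕ)
    (hN : 4 * (m : ℝ) ^ 2 * ((w : ℝ) + 1) ^ 3 ≤ Real.log N) (a : ℚ) (b : Fin w → Fin D → ℚ)
    (hrel : (a : ℝ) + ∑ j : Fin w, ∑ d : Fin D, (b j d : ℝ) *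
      DilogPade.polylogSeries ((j : ℕ) + 1) (1 / (N : ℝ) ^ ((d : ℕ) + 1)) = 0) :
    a = 0 ∧ b = 0 := by
  -- `N ≥ 2`
  have hw1 : (1 : ℝ) ≤ w := by exact_mod_cast hw
  have hm2R : (2 : ℝ) ≤ m := by exact_mod_cast hm
  have hL : (128 : ℝ) ≤ Real.log N := by
    have h2 : (8 : ℝ) ≤ ((w : ℝ) + 1) ^ 3 := by
      have := pow_le_pow_left₀ (by norm_num : (0 : ℝ) ≤ 2) (by linarith : (2 : ℝ) ≤ (w : ℝ) + 1) 3
      norm_num at this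
      exact this
    have h4 : (4 : ℝ) ≤ (m : ℝ) ^ 2 := by nlinarith
    have h3 : (4 : ℝ) * 4 * 8 ≤ 4 * (m : ℝ) ^ 2 * ((w : ℝ) + 1) ^ 3 :=
      mul_le_mul (mul_le_mul_of_nonneg_left h4 (by norm_num)) h2 (by norm_num) (by positivity)
    linarith
  have hN0 : (N : ℝ) ≠ 0 := by
    intro h0; rw [h0, Real.log_zero] at hL; linarith
  have hNpos : (0 : ℝ) < N := lt_of_le_of_ne (Nat.cast_nonneg N) (Ne.symm hN0)
  have hN2R : (2 : ℝ) ≤ N := by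
    have h1 : Real.log N ≤ (N : ℝ) - 1 := Real.log_le_sub_one_of_pos hNpos
    linarith
  have hN2 : 2 ≤ N := by exact_mod_cast hN2R
  have hNQ : (N : ℚ) ≠ 0 := by exact_mod_cast (show N ≠ 0 by omega)
  have hm1 : 1 ≤ m := by omega
  have hDm : D ≤ m := Nat.le_of_dvd (by omega) (hdiv D hD le_rfl)
  -- `M = N^m`, `log M = m log N ≥ 4 m³ (w+1)³`
  have hM : 4 * ((m : ℕ) : ℝ) ^ 3 * ((w : ℝ) + 1) ^ 3 ≤ Real.log ((N ^ m : ℕ) : ℝ) := by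
    push_cast
    rw [Real.log_pow]
    have hpos : (0 : ℝ) ≤ (m : ℝ) := by positivity
    have h1 := mul_le_mul_of_nonneg_left hN hpos
    calc 4 * (m : ℝ) ^ 3 * ((w : ℝ) + 1) ^ 3 = (m : ℝ) * (4 * (m : ℝ) ^ 2 * ((w : ℝ) + 1) ^ 3) := by ring
      _ ≤ (m : ℝ) * Real.log N := h1
  have hcast : (1 / (N : ℝ) ^ m) = 1 / ((N ^ m : ℕ) : ℝ) := by push_cast; ring
  -- the coefficients in the `Φ`-basis
  set Bn : Fin w → ℕ → ℚ := fun j r => ∑ d : Fin D, b j d *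
      (if ((d : ℕ) + 1) ∣ r + 1 then (((d : ℕ) + 1 : ℕ) : ℚ) ^ ((j : ℕ) + 1) * (N : ℚ) ^ (m - (r + 1)) else 0)
    with hBn
  have hsum : ∑ j : Fin w, ∑ r : Fin m, (Bn j r : ℝ) *
      lerchShift m ((r : ℕ) + 1) ((j : ℕ) + 1) (1 / ((N ^ m : ℕ) : ℝ)) =
        ∑ j : Fin w, ∑ d : Fin D, (b j d : ℝ) *
          DilogPade.polylogSeries ((j : ℕ) + 1) (1 / (N : ℝ) ^ ((d : ℕ) + 1)) := by
    rw [← hcast]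
    refine sum_congr rfl fun j _ => ?_
    rw [powers_row hN2 hm1 hdiv ((j : ℕ) + 1) (b j)]
    exact Fin.sum_univ_eq_sum_range
      (fun r => (Bn j r : ℝ) * lerchShift m (r + 1) ((j : ℕ) + 1) (1 / (N : ℝ) ^ m)) m
  have h' : (a : ℝ) + ∑ j : Fin w, ∑ r : Fin m, (Bn j r : ℝ) *
      lerchShift m ((r : ℕ) + 1) ((j : ℕ) + 1) (1 / ((N ^ m : ℕ) : ℝ)) = 0 := by
    rw [hsum]
    exact hrel
  obtain ⟨ha, hBz⟩ := one_lerchShift_linearIndependent m w hm hw (N ^ m) hM a (fun j r => Bn j r) h'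
  -- the equations at `r + 1 = d₀ + 1`, `d₀ < D`
  have hE : ∀ j : Fin w, ∀ d₀ < D,
      (∑ d : Fin D, if ((d : ℕ) + 1) ∣ d₀ + 1 then
        (((d : ℕ) + 1 : ℕ) : ℚ) ^ ((j : ℕ) + 1) * b j d else 0) = 0 := by
    intro j d₀ hd₀
    have hlt : d₀ < m := lt_of_lt_of_le hd₀ hDm
    have h0 := congrFun (congrFun hBz j) ⟨d₀, hlt⟩
    simp only [Pi.zero_apply, hBn] at h0
    have hpow : (N : ℚ) ^ (m - (d₀ + 1)) ≠ 0 := pow_ne_zero _ hNQ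
    have h1 : (N : ℚ) ^ (m - (d₀ + 1)) *
        (∑ d : Fin D, if ((d : ℕ) + 1) ∣ d₀ + 1 then
          (((d : ℕ) + 1 : ℕ) : ℚ) ^ ((j : ℕ) + 1) * b j d else 0) =
        ∑ d : Fin D, b j d * (if ((d : ℕ) + 1) ∣ d₀ + 1 then
          (((d : ℕ) + 1 : ℕ) : ℚ) ^ ((j : ℕ) + 1) * (N : ℚ) ^ (m - (d₀ + 1)) else 0) := by
      rw [mul_sum]
      refine sum_congr rfl fun d _ => ?_
      split_ifs <;> ring
    rw [h0] at h1
    rcases mul_eq_zero.1 h1 with h2 | h2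
    · exact absurd h2 hpow
    · exact h2
  -- the descent, row by row
  have hb : ∀ j : Fin w, b j = 0 := fun j =>
    powers_descent (fun d => (((d : ℕ) + 1 : ℕ) : ℚ) ^ ((j : ℕ) + 1)) (b j)
      (fun d => pow_ne_zero _ (Nat.cast_ne_zero.2 (Nat.succ_ne_zero _))) (hE j)
  exact ⟨ha, funext hb⟩

end Literature.NumberTheory.DiophantineApproximation
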